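import Literature.NumberTheory.ConnesMoscovici2022.UVProlateEigenfunctionEndpoint
import HarnessLib

/-!
# Connes–Moscovici 2022, §1: the Wronskian of two eigenfunctions of `W_sa` with the same eigenvalue
# vanishes on `(λ, ∞)` and on `(−λ, λ)`

Topic `Literature/NumberTheory/ConnesMoscovici2022`.  For the boundary-condition representatives
`g₁, g₂` of two eigenvectors of `W_sa` with the same real eigenvalue `μ` (smooth off `±λ`,
`(p gᵢ′)′ = (q − μ) gᵢ`, boundary condition (1.19) `p gᵢ′ → 0` at `λ`, one-sided limits at `λ` —
`UVProlateEigenfunctionEndpoint.lean`), the generalized Wronskian `[g₁, g₂] = p (g₁ g₂′ − g₂ g₁′)` of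
[ConnesMoscovici2022, (1.6)] has zero derivative off `±λ` (Lagrange identity (1.5) with `Wg₁ = μ g₁`,
`Wg₂ = μ g₂`), hence is constant on `(λ, ∞)` and on `(−λ, λ)`, and tends to `0` at `λ^±`; so it vanishes
on both intervals (`wronskian_repr_eq_zero_Ioi`, `wronskian_repr_eq_zero_Ioo`).  This is the analytic
core of the simplicity of the eigenvalues of `W_sa^±` ([ConnesMoscovici2022, Thm 5.1]: "discrete simple
spectrum"); the remaining step (zero Wronskian ⇒ proportional, by ODE uniqueness) is not done here.
RH-FREE; nothing here bears on the truth of RH.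
-/

noncomputable section

open Complex Set MeasureTheory Filter Topology
open scoped Real Topology ContDiff

namespace Literature.NumberTheory.ConnesMoscovici2022

open Literature.NumberTheory.ConnesConsani2024

variable {lam : ℝ}

/-- `S = ℝ ∖ {±λ}` is open (plumbing). [folklore] -/
private theorem isOpen_S'' (lam : ℝ) : IsOpen {x : ℝ | x ≠ lam ∧ x ≠ -lam} := isOpen_ne.and isOpen_ne

/-- **Lagrange identity for an eigen-pair**: if `(p gᵢ′)′ = (q − μ) gᵢ` (`i = 1, 2`) at `x`, then
`x ↦ p(x)(g₁ g₂′ − g₂ g₁′)(x)` has derivative `0` at `x`.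
[cite: ConnesMoscovici2022, §1 eq. (1.5) (= arXiv:2112.05500 (2.5), chunk p0005:L24–L27)] -/
theorem hasDerivAt_wronskian_zero (lam μ : ℝ) {g₁ g₂ : ℝ → ℂ} {x : ℝ}
    (hg₁ : HasDerivAt g₁ (deriv g₁ x) x) (hg₂ : HasDerivAt g₂ (deriv g₂ x) x)
    (hu₁ : HasDerivAt (fun y => pCoeff lam y * deriv g₁ y) ((qCoeff lam x - μ) * g₁ x) x)
    (hu₂ : HasDerivAt (fun y => pCoeff lam y * deriv g₂ y) ((qCoeff lam x - μ) * g₂ x) x) :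
    HasDerivAt (fun y => pCoeff lam y * deriv g₂ y * g₁ y - pCoeff lam y * deriv g₁ y * g₂ y) 0 x := by
  have h := (hu₂.fun_mul hg₁).fun_sub (hu₁.fun_mul hg₂)
  refine h.congr_deriv ?_
  ring

/-- **Vanishing of the Wronskian from a boundary condition.**  On an open preconnected set `T` off
`±λ` where both `gᵢ` are smooth and satisfy `(p gᵢ′)′ = (q − μ) gᵢ`, the Wronskian
`p (g₂′ g₁ − g₁′ g₂)` is constant; if along some nontrivial filter `l` living in `T` one has
`p gᵢ′ → 0` and `gᵢ → cᵢ`, the constant is `0`.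
[cite: ConnesMoscovici2022, §1 eqs. (1.5)–(1.6), (1.19) (= arXiv:2112.05500 (2.5)–(2.6), (2.19), chunk p0005:L24–L31, p0006:L55–L58)] -/
theorem wronskian_repr_eq_zero_of_tendsto (lam μ : ℝ) {g₁ g₂ : ℝ → ℂ}
    (hsm₁ : ContDiffOn ℝ ∞ g₁ {x | x ≠ lam ∧ x ≠ -lam})
    (hsm₂ : ContDiffOn ℝ ∞ g₂ {x | x ≠ lam ∧ x ≠ -lam})
    (hu₁ : ∀ x ∈ {x : ℝ | x ≠ lam ∧ x ≠ -lam},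
      HasDerivAt (fun y => pCoeff lam y * deriv g₁ y) ((qCoeff lam x - μ) * g₁ x) x)
    (hu₂ : ∀ x ∈ {x : ℝ | x ≠ lam ∧ x ≠ -lam},
      HasDerivAt (fun y => pCoeff lam y * deriv g₂ y) ((qCoeff lam x - μ) * g₂ x) x)
    {T : Set ℝ} (hT : IsOpen T) (hT' : IsPreconnected T) (hTS : T ⊆ {x : ℝ | x ≠ lam ∧ x ≠ -lam})
    (l : Filter ℝ) [NeBot l] (hl : ∀ᶠ x in l, x ∈ T)
    (hbc₁ : Tendsto (fun x => pCoeff lam x * deriv g₁ x) l (𝓝 0))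
    (hbc₂ : Tendsto (fun x => pCoeff lam x * deriv g₂ x) l (𝓝 0))
    {c₁ c₂ : ℂ} (hl₁ : Tendsto g₁ l (𝓝 c₁)) (hl₂ : Tendsto g₂ l (𝓝 c₂)) :
    ∀ x ∈ T, pCoeff lam x * deriv g₂ x * g₁ x - pCoeff lam x * deriv g₁ x * g₂ x = 0 := by
  have hS := isOpen_S'' lam
  have hgd : ∀ (g : ℝ → ℂ), ContDiffOn ℝ ∞ g {x | x ≠ lam ∧ x ≠ -lam} →
      ∀ x ∈ {x : ℝ | x ≠ lam ∧ x ≠ -lam}, HasDerivAt g (deriv g x) x := fun g hg x hx =>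
    ((hg.differentiableOn (by simp) x hx).differentiableAt (hS.mem_nhds hx)).hasDerivAt
  set Wr : ℝ → ℂ := fun y => pCoeff lam y * deriv g₂ y * g₁ y - pCoeff lam y * deriv g₁ y * g₂ y
    with hWr
  have hderiv : ∀ x ∈ T, HasDerivAt Wr 0 x := fun x hx =>
    hasDerivAt_wronskian_zero lam μ (hgd g₁ hsm₁ x (hTS hx)) (hgd g₂ hsm₂ x (hTS hx))
      (hu₁ x (hTS hx)) (hu₂ x (hTS hx))
  have hconst : ∀ x ∈ T, ∀ y ∈ T, Wr x = Wr y := fun x hx y hy =>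
    hT.is_const_of_deriv_eq_zero hT' (fun z hz => (hderiv z hz).differentiableAt.differentiableWithinAt)
      (fun z hz => (hderiv z hz).deriv) hx hy
  have hlim0 : Tendsto Wr l (𝓝 0) := by
    have h := (hbc₂.mul hl₁).sub (hbc₁.mul hl₂)
    rw [zero_mul, zero_mul, sub_zero] at h
    exact h
  intro x hx
  have hlimx : Tendsto Wr l (𝓝 (Wr x)) := by
    refine tendsto_const_nhds.congr' ?_
    filter_upwards [hl] with y hy
    exact hconst x hx y hy
  exact tendsto_nhds_unique hlimx hlim0

/-- **The Wronskian of two eigen-representatives vanishes on `(λ, ∞)`** (boundary condition (1.19) at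
`λ⁺` and one-sided limits there, as provided for eigenvectors of `W_sa` by `CM22_cor_1_7_i`).
[cite: ConnesMoscovici2022, §1 eqs. (1.5)–(1.6), (1.19); Thm 5.1 "discrete simple spectrum" (= arXiv:2112.05500 (2.5)–(2.6), (2.19), Thm 6.1, chunk p0011:L6)] -/
theorem wronskian_repr_eq_zero_Ioi (hlam : 0 < lam) (μ : ℝ) {g₁ g₂ : ℝ → ℂ}
    (hsm₁ : ContDiffOn ℝ ∞ g₁ {x | x ≠ lam ∧ x ≠ -lam})
    (hsm₂ : ContDiffOn ℝ ∞ g₂ {x | x ≠ lam ∧ x ≠ -lam})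
    (hu₁ : ∀ x ∈ {x : ℝ | x ≠ lam ∧ x ≠ -lam},
      HasDerivAt (fun y => pCoeff lam y * deriv g₁ y) ((qCoeff lam x - μ) * g₁ x) x)
    (hu₂ : ∀ x ∈ {x : ℝ | x ≠ lam ∧ x ≠ -lam},
      HasDerivAt (fun y => pCoeff lam y * deriv g₂ y) ((qCoeff lam x - μ) * g₂ x) x)
    (hbc₁ : Tendsto (fun x => pCoeff lam x * deriv g₁ x) (𝓝[>] lam) (𝓝 0))
    (hbc₂ : Tendsto (fun x => pCoeff lam x * deriv g₂ x) (𝓝[>] lam) (𝓝 0))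
    {c₁ c₂ : ℂ} (hl₁ : Tendsto g₁ (𝓝[>] lam) (𝓝 c₁)) (hl₂ : Tendsto g₂ (𝓝[>] lam) (𝓝 c₂)) :
    ∀ x ∈ Ioi lam, pCoeff lam x * deriv g₂ x * g₁ x - pCoeff lam x * deriv g₁ x * g₂ x = 0 :=
  wronskian_repr_eq_zero_of_tendsto lam μ hsm₁ hsm₂ hu₁ hu₂ isOpen_Ioi isPreconnected_Ioi
    (fun x hx => ⟨ne_of_gt hx, by intro h; rw [h] at hx; exact absurd hx (by simp; linarith)⟩)
    (𝓝[>] lam) self_mem_nhdsWithin hbc₁ hbc₂ hl₁ hl₂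

/-- **The Wronskian of two eigen-representatives vanishes on `(−λ, λ)`** (boundary condition (1.19)
at `λ⁻` and one-sided limits there).
[cite: ConnesMoscovici2022, §1 eqs. (1.5)–(1.6), (1.19); Thm 5.1 (= arXiv:2112.05500 (2.5)–(2.6), (2.19), Thm 6.1, chunk p0011:L6)] -/
theorem wronskian_repr_eq_zero_Ioo (hlam : 0 < lam) (μ : ℝ) {g₁ g₂ : ℝ → ℂ}
    (hsm₁ : ContDiffOn ℝ ∞ g₁ {x | x ≠ lam ∧ x ≠ -lam})
    (hsm₂ : ContDiffOn ℝ ∞ g₂ {x | x ≠ lam ∧ x ≠ -lam})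
    (hu₁ : ∀ x ∈ {x : ℝ | x ≠ lam ∧ x ≠ -lam},
      HasDerivAt (fun y => pCoeff lam y * deriv g₁ y) ((qCoeff lam x - μ) * g₁ x) x)
    (hu₂ : ∀ x ∈ {x : ℝ | x ≠ lam ∧ x ≠ -lam},
      HasDerivAt (fun y => pCoeff lam y * deriv g₂ y) ((qCoeff lam x - μ) * g₂ x) x)
    (hbc₁ : Tendsto (fun x => pCoeff lam x * deriv g₁ x) (𝓝[<] lam) (𝓝 0))
    (hbc₂ : Tendsto (fun x => pCoeff lam x * deriv g₂ x) (𝓝[<] lam) (𝓝 0))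
    {c₁ c₂ : ℂ} (hl₁ : Tendsto g₁ (𝓝[<] lam) (𝓝 c₁)) (hl₂ : Tendsto g₂ (𝓝[<] lam) (𝓝 c₂)) :
    ∀ x ∈ Ioo (-lam) lam, pCoeff lam x * deriv g₂ x * g₁ x - pCoeff lam x * deriv g₁ x * g₂ x = 0 :=
  wronskian_repr_eq_zero_of_tendsto lam μ hsm₁ hsm₂ hu₁ hu₂ isOpen_Ioo isPreconnected_Ioo
    (fun x hx => ⟨ne_of_lt hx.2, by intro h; rw [h] at hx; linarith [hx.1]⟩)
    (𝓝[<] lam) (by rw [← nhdsWithin_Ioo_eq_nhdsLT (neg_lt_self hlam)]; exact self_mem_nhdsWithin)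
    hbc₁ hbc₂ hl₁ hl₂

/-- **For two eigenvectors of `W_sa` with the same real eigenvalue, the Wronskian of their
boundary-condition representatives vanishes on `(λ, ∞)` and on `(−λ, λ)`.**
[cite: ConnesMoscovici2022, §1 eqs. (1.5)–(1.6), (1.19); Thm 5.1 (= arXiv:2112.05500 (2.5)–(2.6), (2.19), Thm 6.1, chunk p0011:L6)] -/
theorem exists_repr_wronskian_eq_zero (lam : ℝ) (hlam : 0 < lam) {W : L2R →ₗ.[ℂ] L2R}
    (hSA : IsProlateSA lam W) (μ : ℝ) {φ₁ φ₂ : L2R} (hev₁ : W.HasEigenvector (μ : ℂ) φ₁)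
    (hev₂ : W.HasEigenvector (μ : ℂ) φ₂) :
    ∃ g₁ g₂ : ℝ → ℂ, (φ₁ : ℝ → ℂ) =ᵐ[volume] g₁ ∧ (φ₂ : ℝ → ℂ) =ᵐ[volume] g₂ ∧
      ProlateBC lam g₁ ∧ ProlateBC lam g₂ ∧
      ContDiffOn ℝ (⊤ : ℕ∞) g₁ {x | x ≠ lam ∧ x ≠ -lam} ∧ ContDiffOn ℝ (⊤ : ℕ∞) g₂ {x | x ≠ lam ∧ x ≠ -lam} ∧
      (∀ x ∈ Ioi lam ∪ Ioo (-lam) lam,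
        pCoeff lam x * deriv g₂ x * g₁ x - pCoeff lam x * deriv g₁ x * g₂ x = 0) := by
  obtain ⟨g₁, hfg₁, ⟨ε₁, -, -, -, ⟨cR₁, hcR₁⟩, cL₁, hcL₁⟩, hbc₁, hsm₁⟩ := CM22_cor_1_7_i lam hlam W hSA μ φ₁ hev₁
  obtain ⟨g₂, hfg₂, ⟨ε₂, -, -, -, ⟨cR₂, hcR₂⟩, cL₂, hcL₂⟩, hbc₂, hsm₂⟩ := CM22_cor_1_7_i lam hlam W hSA μ φ₂ hev₂
  obtain ⟨hφ₁, hW₁, -⟩ := exists_repr_of_hasEigenvector hSA hev₁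
  obtain ⟨hφ₂, hW₂, -⟩ := exists_repr_of_hasEigenvector hSA hev₂
  have hu₁ : ∀ x ∈ {x : ℝ | x ≠ lam ∧ x ≠ -lam},
      HasDerivAt (fun y => pCoeff lam y * deriv g₁ y) ((qCoeff lam x - μ) * g₁ x) x :=
    fun x hx => hasDerivAt_pCoeff_mul_deriv_repr hlam hφ₁ hW₁ hfg₁ hbc₁.differentiableOn hx.1 hx.2
  have hu₂ : ∀ x ∈ {x : ℝ | x ≠ lam ∧ x ≠ -lam},
      HasDerivAt (fun y => pCoeff lam y * deriv g₂ y) ((qCoeff lam x - μ) * g₂ x) x :=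
    fun x hx => hasDerivAt_pCoeff_mul_deriv_repr hlam hφ₂ hW₂ hfg₂ hbc₂.differentiableOn hx.1 hx.2
  -- the boundary condition (1.19) at λ from each side
  have hR : ∀ {g : ℝ → ℂ}, ProlateBC lam g →
      Tendsto (fun x => pCoeff lam x * deriv g x) (𝓝[>] lam) (𝓝 0) := fun hbc =>
    hbc.atLam.mono_left (nhdsWithin_mono _ fun x hx =>
      ⟨ne_of_gt hx, by intro h; rw [h] at hx; exact absurd hx (by simp; linarith)⟩)
  have hL : ∀ {g : ℝ → ℂ}, ProlateBC lam g →
      Tendsto (fun x => pCoeff lam x * deriv g x) (𝓝[<] lam) (𝓝 0) := fun hbc => by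
    rw [← nhdsWithin_Ioo_eq_nhdsLT (neg_lt_self hlam)]
    exact hbc.atLam.mono_left (nhdsWithin_mono _ fun x hx =>
      ⟨ne_of_lt hx.2, by intro h; rw [h] at hx; linarith [hx.1]⟩)
  refine ⟨g₁, g₂, hfg₁, hfg₂, hbc₁, hbc₂, hsm₁, hsm₂, fun x hx => ?_⟩
  rcases hx with hx | hx
  · exact wronskian_repr_eq_zero_Ioi hlam μ hsm₁ hsm₂ hu₁ hu₂ (hR hbc₁) (hR hbc₂) hcR₁ hcR₂ x hx
  · exact wronskian_repr_eq_zero_Ioo hlam μ hsm₁ hsm₂ hu₁ hu₂ (hL hbc₁) (hL hbc₂) hcL₁ hcL₂ x hx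

end Literature.NumberTheory.ConnesMoscovici2022
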